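import Mathlib.Analysis.Calculus.MeanValue
import Mathlib.Analysis.Calculus.Deriv.Slope
import Mathlib.Topology.Baire.Lemmas
import Mathlib.Topology.Baire.CompleteMetrizable
import Literature.Analysis.FluidPDE.ClassicalSolutionCalculus
import HarnessLib

/-!
# Mixed partial derivatives of space–time fields commute on arbitrary time sets

Analysis/FluidPDE support file (pure calculus, no fluid mechanics). For a field `w : ℝ → X → F`
that is jointly smooth on `S × X` in the tree's within-set sense
(`Literature.Analysis.FluidPDE.IsSmoothSpaceTimeOn S w`, i.e.
`ContDiffOn ℝ ∞ (uncurry w) (S ×ˢ univ)`; `C²` suffices for the main lemma), `S ⊆ ℝ` an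
**arbitrary** set of unique differentiability and `X` a complete normed space, the one-sided time
derivative within `S` (`Literature.Analysis.FluidPDE.timeDerivWithin S`, Mathlib's `derivWithin`)
commutes with spatial derivatives:
`∂ₜ (D(w ·)(x) v) (t) = D(∂ₜ w (t)) (x) v` for every `t ∈ S`
(`IsSmoothSpaceTimeOn.timeDerivWithin_fderiv_slice_apply_of_uniqueDiffOn`). Equivalently, the
second derivative of `W = uncurry w` within `S ×ˢ univ` is symmetric on the pairs `((1, 0), (0, v))`
(`fderivWithin_fderivWithin_symm_of_prod_univ`).

`EnergyToolkit` proves the exchange under the extra hypothesis `S ⊆ closure (interior S)` (every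
interval), from Mathlib's `ContDiffWithinAt.isSymmSndFDerivWithinAt` (Schwarz's theorem within a
set, available at points of the closure of the interior). On a general set of unique
differentiability — a Cantor set, `ℚ ∩ [0, 1]`, … — there is no mean-value theorem in the time
direction and that route is closed. The exchange nevertheless holds as soon as ONE of the two
directions is a genuine vector-space direction, by the following Baire-category upgrade of the
classical proof of the symmetry of second derivatives (we could not locate this variant in print;
the classical statement and proof are e.g. Rudin, *Principles of Mathematical Analysis*, Thm. 9.41).

Write `A = S × X`, `D = fderivWithin W A`, `D₂ = fderivWithin D A`, fix `t ∈ S`, `v ∈ X`, and put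
`M(y) = D₂(t,y)(1,0)(0,v)`, `N(y) = D₂(t,y)(0,v)(1,0)`; both are continuous in `y` (`W ∈ C²`).
1. *Baire.* For `ε > 0` the sets
   `Eₙ = {y | ‖D(t+k, y+w) − D(t,y) − D₂(t,y)(k,w)‖ ≤ ε(|k|+‖w‖) whenever t+k ∈ S, |k|, ‖w‖ ≤ 1/(n+1)}`
   are closed and cover `X` (differentiability of `D` within `A` at `(t, y)`), so by Baire's theorem
   some `Eₙ` contains a ball `B(y, ρ)` with `y` inside any prescribed ball around `x`.
2. *Uniform step.* On `B(y, ρ)` the first-order expansion of `D` in the time direction is uniform;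
   the mean value inequality along the space segment `[y, y + hv]` then gives
   `‖Δ(h,k) − hk·M(y)‖ ≤ |k| h (ε‖v‖ + η)` for the second difference
   `Δ(h,k) = W(t+k,y+hv) − W(t+k,y) − W(t,y+hv) + W(t,y)` (`t+k ∈ S`, `k` small), where `η` bounds
   the oscillation of `M` on the segment.
3. *Limits.* `Δ(h,k)/k → ∂ₜW(t,y+hv) − ∂ₜW(t,y)` as `k → 0` within `S` (`t` is an accumulation
   point of `S`, `UniqueDiffWithinAt.accPt`), and the right-hand side is `h·N(y) + o(h)`; hence
   `‖N(y) − M(y)‖ ≤ ε‖v‖`.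
4. Such `y` exist arbitrarily close to `x`; continuity of `M − N` and `ε → 0` give `M(x) = N(x)`.

This closes the gap recorded in `VorticityEquation.lean` ("the exchange of mixed
within-derivatives is only available on `S ⊆ closure (interior S)`"): the velocity ⇒ vorticity
passage holds on every time set of unique differentiability (`VorticityProofs.lean`).

## Main statements

* `fderivWithin_fderivWithin_symm_of_prod_univ`: for `W : ℝ × X → F` of class `C²` within
  `S ×ˢ univ`, `UniqueDiffOn ℝ S`, `X` complete, `t ∈ S`:
  `D²_A W (t,x) (1,0) (0,v) = D²_A W (t,x) (0,v) (1,0)`.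
* `IsSmoothSpaceTimeOn.timeDerivWithin_fderiv_slice_apply_of_uniqueDiffOn`:
  `timeDerivWithin S (fun s y ↦ fderiv ℝ (w s) y v) t x = fderiv ℝ (timeDerivWithin S w t) x v`
  for every `t ∈ S` — `EnergyToolkit`'s `timeDerivWithin_fderiv_slice_apply` without the
  hypothesis `S ⊆ closure (interior S)`.

## References

* W. Rudin, *Principles of Mathematical Analysis*, 3rd ed. (McGraw–Hill 1976), Thm. 9.41
  (symmetry of mixed partials; the argument adapted above).
* A. J. Majda, A. L. Bertozzi, *Vorticity and Incompressible Flow* (CUP 2002), §1.4, proof of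
  Prop. 1.5, eq. (1.29) (the tacit exchange `(v_{x_k})_t = (v_t)_{x_k}` when differentiating the
  Navier–Stokes equation in space) — the use this file serves.
-/

noncomputable section

open Set Function Filter Metric
open scoped Topology ContDiff

namespace Literature.Analysis.FluidPDE

section MixedPartials

variable {X : Type*} [NormedAddCommGroup X] [NormedSpace ℝ X] [CompleteSpace X]
variable {F : Type*} [NormedAddCommGroup F] [NormedSpace ℝ F]

/-- **Mixed second derivatives within `S × X` are symmetric in a time–space pair of directions.**
Let `S ⊆ ℝ` be a set of unique differentiability, `X` a complete real normed space,
`W : ℝ × X → F` of class `C²` within `A = S ×ˢ univ`, `t ∈ S`, `x v ∈ X`. Then the second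
derivative within `A`, `D²_A W (t, x) = fderivWithin ℝ (fderivWithin ℝ W A) A (t, x)`, satisfies
`D²_A W (t,x) (1,0) (0,v) = D²_A W (t,x) (0,v) (1,0)` — although `(t, x)` need not lie in the
closure of the interior of `A` (no mean-value theorem in the `S`-direction). Proof: the
Baire-category argument of the module docstring (closed sets `Eₙ` of uniform first-order expansion
of `D = fderivWithin W A` in time, a ball inside some `Eₙ` by Baire's theorem in the complete space
`X`, the mean value inequality along space segments, the limit `k → 0` within `S` at the
accumulation point `t`, and continuity of both mixed partials in the space variable). [folklore] -/
theorem fderivWithin_fderivWithin_symm_of_prod_univ {S : Set ℝ} {W : ℝ × X → F}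
    (hW : ContDiffOn ℝ 2 W (S ×ˢ univ)) (hS : UniqueDiffOn ℝ S) {t : ℝ} (ht : t ∈ S) (x v : X) :
    fderivWithin ℝ (fderivWithin ℝ W (S ×ˢ univ)) (S ×ˢ univ) (t, x) ((1 : ℝ), (0 : X))
        ((0 : ℝ), v) =
      fderivWithin ℝ (fderivWithin ℝ W (S ×ˢ univ)) (S ×ˢ univ) (t, x) ((0 : ℝ), v)
        ((1 : ℝ), (0 : X)) := by
  -- the set, the first and the second derivative within it
  set A : Set (ℝ × X) := S ×ˢ (univ : Set X) with hA_def
  set D : ℝ × X → ℝ × X →L[ℝ] F := fderivWithin ℝ W A with hD_def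
  set D₂ : ℝ × X → ℝ × X →L[ℝ] ℝ × X →L[ℝ] F := fderivWithin ℝ D A with hD₂_def
  have hU : UniqueDiffOn ℝ A := hS.prod uniqueDiffOn_univ
  have memA : ∀ {s : ℝ}, s ∈ S → ∀ y : X, (s, y) ∈ A := fun hs y => mk_mem_prod hs (mem_univ y)
  have hD1 : ContDiffOn ℝ 1 D A := hW.fderivWithin hU (le_of_eq one_add_one_eq_two)
  have hW_at : ∀ {s : ℝ}, s ∈ S → ∀ y : X, HasFDerivWithinAt W (D (s, y)) A (s, y) :=
    fun hs y => ((hW _ (memA hs y)).differentiableWithinAt two_ne_zero).hasFDerivWithinAt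
  have hD_at : ∀ {s : ℝ}, s ∈ S → ∀ y : X, HasFDerivWithinAt D (D₂ (s, y)) A (s, y) :=
    fun hs y => ((hD1 _ (memA hs y)).differentiableWithinAt one_ne_zero).hasFDerivWithinAt
  have hD₂c : ContinuousOn D₂ A := hD1.continuousOn_fderivWithin hU le_rfl
  -- space slices at times in `S`, and time lines within `S`
  have hW_sl : ∀ {s : ℝ}, s ∈ S → ∀ y : X,
      HasFDerivAt (fun y' : X => W (s, y')) ((D (s, y)).comp (ContinuousLinearMap.inr ℝ ℝ X)) y :=
    fun {s} hs y => (hW_at hs y).comp_hasFDerivAt y (hasFDerivAt_prodMk_right s y)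
      (Eventually.of_forall fun y' => memA hs y')
  have hD_sl : ∀ {s : ℝ}, s ∈ S → ∀ y : X,
      HasFDerivAt (fun y' : X => D (s, y')) ((D₂ (s, y)).comp (ContinuousLinearMap.inr ℝ ℝ X)) y :=
    fun {s} hs y => (hD_at hs y).comp_hasFDerivAt y (hasFDerivAt_prodMk_right s y)
      (Eventually.of_forall fun y' => memA hs y')
  have hW_tl : ∀ y : X,
      HasDerivWithinAt (fun r : ℝ => W (r, y)) (D (t, y) ((1 : ℝ), (0 : X))) S t :=
    fun y => (hW_at ht y).comp_hasDerivWithinAt t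
      ((hasDerivWithinAt_id t S).prodMk (hasDerivWithinAt_const t S y)) fun r hr => memA hr y
  have hDc_sl : ∀ {s : ℝ}, s ∈ S → Continuous fun y : X => D (s, y) :=
    fun hs => continuous_iff_continuousAt.2 fun y => (hD_sl hs y).continuousAt
  have hD₂c_sl : Continuous fun y : X => D₂ (t, y) :=
    hD₂c.comp_continuous (continuous_const.prodMk continuous_id) fun y => memA ht y
  -- the two mixed partials as (continuous) functions of the space point
  set M : X → F := fun y => D₂ (t, y) ((1 : ℝ), (0 : X)) ((0 : ℝ), v) with hM_def
  set N : X → F := fun y => D₂ (t, y) ((0 : ℝ), v) ((1 : ℝ), (0 : X)) with hN_def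
  have hMc : Continuous M := (hD₂c_sl.clm_apply continuous_const).clm_apply continuous_const
  have hNc : Continuous N := (hD₂c_sl.clm_apply continuous_const).clm_apply continuous_const
  change M x = N x
  -- accumulation: `t` is a limit point of `S`
  haveI hNe : (𝓝[S \ {t}] t).NeBot := accPt_principal_iff_nhdsWithin.1 (hS t ht).accPt
  -- the heart of the matter: near `x` there are points where the two mixed partials almost agree
  have key : ∀ ε : ℝ, 0 < ε → ∀ r : ℝ, 0 < r → ∃ y ∈ ball x r, ‖N y - M y‖ ≤ ε * ‖v‖ := by
    intro ε hε r hr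
    -- (1) Baire: the closed sets `E n` of uniform first-order expansion of `D` at `(t, y)`
    set E : ℕ → Set X := fun n => ⋂ (k : ℝ) (_ : t + k ∈ S) (_ : |k| ≤ 1 / ((n : ℝ) + 1)) (w : X)
        (_ : ‖w‖ ≤ 1 / ((n : ℝ) + 1)),
        {y : X | ‖D (t + k, y + w) - D (t, y) - D₂ (t, y) (k, w)‖ ≤ ε * (|k| + ‖w‖)} with hE_def
    have hE_closed : ∀ n, IsClosed (E n) := fun n =>
      isClosed_iInter fun k => isClosed_iInter fun hk => isClosed_iInter fun _ =>
        isClosed_iInter fun w => isClosed_iInter fun _ =>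
          isClosed_le ((((hDc_sl hk).comp (continuous_id.add continuous_const)).sub
            (hDc_sl ht)).sub (hD₂c_sl.clm_apply continuous_const)).norm continuous_const
    have hE_cover : (⋃ n, E n) = univ := by
      refine eq_univ_of_forall fun y => ?_
      obtain ⟨δ, hδ, hδ'⟩ := Metric.eventually_nhds_iff.1
        (eventually_nhdsWithin_iff.1 ((hD_at ht y).isLittleO.def hε))
      obtain ⟨n, hn⟩ := exists_nat_one_div_lt hδ
      refine mem_iUnion.2 ⟨n, ?_⟩
      simp only [hE_def, mem_iInter, mem_setOf_eq]
      intro k hk hkn w hwn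
      have hdist : dist ((t + k, y + w) : ℝ × X) (t, y) < δ := by
        rw [dist_eq_norm, Prod.mk_sub_mk, add_sub_cancel_left, add_sub_cancel_left, Prod.norm_mk,
          Real.norm_eq_abs]
        exact max_lt (hkn.trans_lt hn) (hwn.trans_lt hn)
      have h1 := hδ' hdist (memA hk (y + w))
      rw [Prod.mk_sub_mk, add_sub_cancel_left, add_sub_cancel_left, Prod.norm_mk,
        Real.norm_eq_abs] at h1
      refine h1.trans ?_
      gcongr
      exact max_le (le_add_of_nonneg_right (norm_nonneg _)) (le_add_of_nonneg_left (abs_nonneg _))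
    have hdense : Dense (⋃ n, interior (E n)) :=
      dense_iUnion_interior_of_closed hE_closed hE_cover
    obtain ⟨y, hy, hyr⟩ := hdense.exists_mem_open isOpen_ball ⟨x, mem_ball_self hr⟩
    obtain ⟨n, hn⟩ := mem_iUnion.1 hy
    obtain ⟨ρ, hρ, hball⟩ := Metric.mem_nhds_iff.1 (mem_interior_iff_mem_nhds.1 hn)
    -- (2) uniform first-order expansion of `D` in time on the ball `B(y, ρ)`
    have hunif : ∀ y₁ ∈ ball y ρ, ∀ k : ℝ, t + k ∈ S → |k| ≤ 1 / ((n : ℝ) + 1) →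
        ‖D (t + k, y₁) ((0 : ℝ), v) - D (t, y₁) ((0 : ℝ), v) - k • M y₁‖ ≤ ε * |k| * ‖v‖ := by
      intro y₁ hy₁ k hk hkn
      have h1 := hball hy₁
      simp only [hE_def, mem_iInter, mem_setOf_eq] at h1
      have h2 := h1 k hk hkn 0 (by rw [norm_zero]; positivity)
      rw [add_zero, norm_zero, add_zero] at h2
      have h3 : (D (t + k, y₁) - D (t, y₁) - D₂ (t, y₁) (k, (0 : X))) ((0 : ℝ), v) =
          D (t + k, y₁) ((0 : ℝ), v) - D (t, y₁) ((0 : ℝ), v) - k • M y₁ := by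
        have hk0 : ((k, (0 : X)) : ℝ × X) = k • ((1 : ℝ), (0 : X)) := by simp
        rw [hk0, map_smul]
        simp only [hM_def, _root_.sub_apply, _root_.smul_apply]
      calc ‖D (t + k, y₁) ((0 : ℝ), v) - D (t, y₁) ((0 : ℝ), v) - k • M y₁‖
          = ‖(D (t + k, y₁) - D (t, y₁) - D₂ (t, y₁) (k, (0 : X))) ((0 : ℝ), v)‖ := by rw [h3]
        _ ≤ ‖D (t + k, y₁) - D (t, y₁) - D₂ (t, y₁) (k, (0 : X))‖ * ‖((0 : ℝ), v)‖ :=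
          ContinuousLinearMap.le_opNorm _ _
        _ ≤ ε * |k| * ‖v‖ := by
          rw [Prod.norm_mk, norm_zero, max_eq_right (norm_nonneg v)]
          exact mul_le_mul_of_nonneg_right h2 (norm_nonneg v)
    refine ⟨y, hyr, le_of_forall_pos_le_add fun η hη => ?_⟩
    -- a continuity radius of `M` at `y`
    obtain ⟨ρ', hρ', hMy⟩ := Metric.continuousAt_iff.1 hMc.continuousAt η hη
    -- (3) the second-difference estimate along `[y, y + h v] × {t, t + k}`
    have hΔ : ∀ h : ℝ, 0 < h → h * ‖v‖ < min ρ ρ' → ∀ k : ℝ, t + k ∈ S →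
        |k| ≤ 1 / ((n : ℝ) + 1) →
        ‖W (t + k, y + h • v) - W (t, y + h • v) - (W (t + k, y) - W (t, y)) - (h * k) • M y‖ ≤
          |k| * (ε * ‖v‖ + η) * h := by
      intro h hh hhv k hk hkn
      have hseg : ∀ σ ∈ Icc (0 : ℝ) h, dist (y + σ • v) y < min ρ ρ' := fun σ hσ => by
        rw [dist_eq_norm, add_sub_cancel_left, norm_smul, Real.norm_eq_abs, abs_of_nonneg hσ.1]
        exact (mul_le_mul_of_nonneg_right hσ.2 (norm_nonneg v)).trans_lt hhv
      have hderiv : ∀ σ ∈ Icc (0 : ℝ) h,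
          HasDerivWithinAt
            (fun σ' : ℝ => W (t + k, y + σ' • v) - W (t, y + σ' • v) - (σ' * k) • M y)
            (D (t + k, y + σ • v) ((0 : ℝ), v) - D (t, y + σ • v) ((0 : ℝ), v) - k • M y)
            (Icc 0 h) σ := by
        intro σ _
        have hl : HasDerivAt (fun σ' : ℝ => y + σ' • v) v σ := by
          simpa using ((hasDerivAt_id σ).smul_const v).const_add y
        have h1 : HasDerivAt (fun σ' : ℝ => W (t + k, y + σ' • v))
            (D (t + k, y + σ • v) ((0 : ℝ), v)) σ := by
          have := (hW_sl hk (y + σ • v)).comp_hasDerivAt σ hl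
          simpa [Function.comp_def] using this
        have h2 : HasDerivAt (fun σ' : ℝ => W (t, y + σ' • v))
            (D (t, y + σ • v) ((0 : ℝ), v)) σ := by
          have := (hW_sl ht (y + σ • v)).comp_hasDerivAt σ hl
          simpa [Function.comp_def] using this
        have h3 : HasDerivAt (fun σ' : ℝ => (σ' * k) • M y) (k • M y) σ := by
          simpa using ((hasDerivAt_id σ).mul_const k).smul_const (M y)
        exact ((h1.sub h2).sub h3).hasDerivWithinAt
      have hbound : ∀ σ ∈ Ico (0 : ℝ) h,
          ‖D (t + k, y + σ • v) ((0 : ℝ), v) - D (t, y + σ • v) ((0 : ℝ), v) - k • M y‖ ≤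
            |k| * (ε * ‖v‖ + η) := by
        intro σ hσ
        have hy₁ := hseg σ (Ico_subset_Icc_self hσ)
        have e1 := hunif (y + σ • v) (hy₁.trans_le (min_le_left _ _)) k hk hkn
        have e2 : ‖M (y + σ • v) - M y‖ ≤ η := by
          rw [← dist_eq_norm]; exact (hMy (hy₁.trans_le (min_le_right _ _))).le
        calc ‖D (t + k, y + σ • v) ((0 : ℝ), v) - D (t, y + σ • v) ((0 : ℝ), v) - k • M y‖
            = ‖(D (t + k, y + σ • v) ((0 : ℝ), v) - D (t, y + σ • v) ((0 : ℝ), v)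
                  - k • M (y + σ • v)) + k • (M (y + σ • v) - M y)‖ := by
              congr 1; rw [smul_sub]; abel
          _ ≤ ‖D (t + k, y + σ • v) ((0 : ℝ), v) - D (t, y + σ • v) ((0 : ℝ), v)
                  - k • M (y + σ • v)‖ + ‖k • (M (y + σ • v) - M y)‖ := norm_add_le _ _
          _ ≤ ε * |k| * ‖v‖ + |k| * η := by
              refine add_le_add e1 ?_
              rw [norm_smul, Real.norm_eq_abs]
              exact mul_le_mul_of_nonneg_left e2 (abs_nonneg k)
          _ = |k| * (ε * ‖v‖ + η) := by ring
      have hmv : ‖(W (t + k, y + h • v) - W (t, y + h • v) - (h * k) • M y) -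
          (W (t + k, y + (0 : ℝ) • v) - W (t, y + (0 : ℝ) • v) - ((0 : ℝ) * k) • M y)‖ ≤
          |k| * (ε * ‖v‖ + η) * (h - 0) :=
        norm_image_sub_le_of_norm_deriv_le_segment' hderiv hbound h (right_mem_Icc.2 hh.le)
      simp only [zero_smul, add_zero, zero_mul, sub_zero] at hmv
      calc ‖W (t + k, y + h • v) - W (t, y + h • v) - (W (t + k, y) - W (t, y)) - (h * k) • M y‖
          = ‖W (t + k, y + h • v) - W (t, y + h • v) - (h * k) • M y
              - (W (t + k, y) - W (t, y))‖ := by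
            congr 1; abel
        _ ≤ |k| * (ε * ‖v‖ + η) * h := hmv
    -- (4) the limit `k → 0` within `S`: `‖P h - h • M y‖ ≤ h (ε ‖v‖ + η)`
    have hP : ∀ h : ℝ, 0 < h → h * ‖v‖ < min ρ ρ' →
        ‖D (t, y + h • v) ((1 : ℝ), (0 : X)) - D (t, y) ((1 : ℝ), (0 : X)) - h • M y‖ ≤
          h * (ε * ‖v‖ + η) := by
      intro h hh hhv
      have hφ : HasDerivWithinAt (fun r : ℝ => W (r, y + h • v) - W (r, y))
          (D (t, y + h • v) ((1 : ℝ), (0 : X)) - D (t, y) ((1 : ℝ), (0 : X))) S t :=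
        (hW_tl (y + h • v)).sub (hW_tl y)
      have htend := ((hasDerivWithinAt_iff_tendsto_slope.1 hφ).sub_const (h • M y)).norm
      refine le_of_tendsto htend ?_
      rw [eventually_nhdsWithin_iff, Metric.eventually_nhds_iff]
      refine ⟨1 / ((n : ℝ) + 1), by positivity, fun r hr hrS => ?_⟩
      obtain ⟨hrS, hrt⟩ := hrS
      have hrt' : r - t ≠ 0 := sub_ne_zero.2 (by rintro rfl; exact hrt (mem_singleton r))
      have hk : t + (r - t) ∈ S := by rwa [add_sub_cancel]
      have hkn : |r - t| ≤ 1 / ((n : ℝ) + 1) := by rw [← Real.dist_eq]; exact hr.le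
      have e1 := hΔ h hh hhv (r - t) hk hkn
      rw [add_sub_cancel] at e1
      have e0 : W (r, y + h • v) - W (t, y + h • v) - (W (r, y) - W (t, y)) =
          (W (r, y + h • v) - W (r, y)) - (W (t, y + h • v) - W (t, y)) := by abel
      rw [e0] at e1
      simp only [slope_def_module]
      have e2 : (r - t)⁻¹ • ((W (r, y + h • v) - W (r, y)) - (W (t, y + h • v) - W (t, y)))
            - h • M y =
          (r - t)⁻¹ • ((W (r, y + h • v) - W (r, y)) - (W (t, y + h • v) - W (t, y))
            - (h * (r - t)) • M y) := by
        conv_rhs => rw [smul_sub, smul_smul, mul_comm h (r - t), inv_mul_cancel_left₀ hrt']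
      rw [e2, norm_smul, norm_inv, Real.norm_eq_abs, inv_mul_le_iff₀ (abs_pos.2 hrt')]
      calc ‖(W (r, y + h • v) - W (r, y)) - (W (t, y + h • v) - W (t, y))
              - (h * (r - t)) • M y‖
          ≤ |r - t| * (ε * ‖v‖ + η) * h := e1
        _ = |r - t| * (h * (ε * ‖v‖ + η)) := by ring
    -- (5) the limit `h → 0⁺`: `P h = h • N y + o(h)`
    have hψ : HasDerivAt (fun h : ℝ => D (t, y + h • v) ((1 : ℝ), (0 : X))) (N y) 0 := by
      have hl : HasDerivAt (fun h : ℝ => y + h • v) v 0 := by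
        simpa using ((hasDerivAt_id (0 : ℝ)).smul_const v).const_add y
      have h1 : HasDerivAt (fun h : ℝ => D (t, y + h • v)) (D₂ (t, y) ((0 : ℝ), v)) 0 := by
        have := (hD_sl ht (y + (0 : ℝ) • v)).comp_hasDerivAt (0 : ℝ) hl
        simpa [Function.comp_def] using this
      have h2 := h1.clm_apply (hasDerivAt_const (0 : ℝ) (((1 : ℝ), (0 : X)) : ℝ × X))
      simpa [hN_def] using h2
    have hψt : Tendsto
        (fun h : ℝ => h⁻¹ • (D (t, y + h • v) ((1 : ℝ), (0 : X)) - D (t, y) ((1 : ℝ), (0 : X))))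
        (𝓝[>] (0 : ℝ)) (𝓝 (N y)) := by
      have := (hasDerivAt_iff_tendsto_slope.1 hψ).mono_left
        (nhdsWithin_mono _ fun h (hh : 0 < h) => hh.ne')
      refine this.congr' (Eventually.of_forall fun h => ?_)
      simp only [slope_def_module, sub_zero, zero_smul, add_zero]
    have hev : ∀ᶠ h in 𝓝[>] (0 : ℝ),
        ‖h⁻¹ • (D (t, y + h • v) ((1 : ℝ), (0 : X)) - D (t, y) ((1 : ℝ), (0 : X))) - M y‖ ≤
          ε * ‖v‖ + η := by
      have hsmall : ∀ᶠ h in 𝓝[>] (0 : ℝ), h * ‖v‖ < min ρ ρ' := by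
        have h0 : Tendsto (fun h : ℝ => h * ‖v‖) (𝓝[>] 0) (𝓝 (0 * ‖v‖)) :=
          (tendsto_id.mul_const ‖v‖).mono_left nhdsWithin_le_nhds
        rw [zero_mul] at h0
        exact h0.eventually (gt_mem_nhds (lt_min hρ hρ'))
      filter_upwards [hsmall, self_mem_nhdsWithin] with h hhv hh
      have hh : 0 < h := hh
      have e1 := hP h hh hhv
      have e2 : h⁻¹ • (D (t, y + h • v) ((1 : ℝ), (0 : X)) - D (t, y) ((1 : ℝ), (0 : X))) - M y =
          h⁻¹ • (D (t, y + h • v) ((1 : ℝ), (0 : X)) - D (t, y) ((1 : ℝ), (0 : X)) - h • M y) := by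
        rw [smul_sub h⁻¹ (_ - _), inv_smul_smul₀ hh.ne']
      rw [e2, norm_smul, norm_inv, Real.norm_eq_abs, abs_of_pos hh, inv_mul_le_iff₀ hh]
      exact e1
    exact le_of_tendsto ((hψt.sub_const (M y)).norm) hev
  -- conclusion: `‖N x - M x‖` is arbitrarily small
  have hfin : ∀ ε : ℝ, 0 < ε → ‖N x - M x‖ ≤ ε * ‖v‖ + ε := by
    intro ε hε
    obtain ⟨r, hr, hr'⟩ := Metric.continuousAt_iff.1 (hNc.sub hMc).continuousAt ε hε
    obtain ⟨y, hy, hyb⟩ := key ε hε r hr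
    have e1 : dist (N y - M y) (N x - M x) < ε := hr' hy
    rw [dist_eq_norm] at e1
    calc ‖N x - M x‖ ≤ ‖N y - M y‖ + ‖N y - M y - (N x - M x)‖ := norm_le_insert _ _
      _ ≤ ε * ‖v‖ + ε := add_le_add hyb e1.le
  have hzero : ‖N x - M x‖ ≤ 0 := by
    refine le_of_forall_pos_le_add fun ε hε => ?_
    have hv1 : (0 : ℝ) < ‖v‖ + 1 := by positivity
    have h1 := hfin (ε / (‖v‖ + 1)) (div_pos hε hv1)
    rw [zero_add]
    calc ‖N x - M x‖ ≤ ε / (‖v‖ + 1) * ‖v‖ + ε / (‖v‖ + 1) := h1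
      _ = ε := by field_simp
  exact (sub_eq_zero.1 (norm_le_zero_iff.1 hzero)).symm

/-- **Exchange of the one-sided time derivative with spatial derivatives, on every time set of
unique differentiability.** For a field `w : ℝ → X → F` jointly smooth on `S × X` (`X` complete),
`S` of unique differentiability and `t ∈ S`,
`∂ₜ (D(w ·)(x) v) (t) = D(∂ₜ w (t)) (x) v` with `∂ₜ = timeDerivWithin S`. This is `EnergyToolkit`'s
`IsSmoothSpaceTimeOn.timeDerivWithin_fderiv_slice_apply` without its hypothesis
`S ⊆ closure (interior S)`: both sides are the values of the second derivative of `uncurry w` within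
`S × X` at `(t, x)` on `((1,0),(0,v))` resp. `((0,v),(1,0))` (chain rule along `s ↦ (s, x)` within `S`
and along `y ↦ (t, y)`), which agree by `fderivWithin_fderivWithin_symm_of_prod_univ`. [folklore] -/
theorem IsSmoothSpaceTimeOn.timeDerivWithin_fderiv_slice_apply_of_uniqueDiffOn {S : Set ℝ}
    {w : ℝ → X → F} (h : IsSmoothSpaceTimeOn S w) (hS : UniqueDiffOn ℝ S) {t : ℝ} (ht : t ∈ S)
    (x v : X) :
    FluidPDE.timeDerivWithin S (fun s y => fderiv ℝ (w s) y v) t x =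
      fderiv ℝ (FluidPDE.timeDerivWithin S w t) x v := by
  set W : ℝ × X → F := uncurry w with hW
  set s : Set (ℝ × X) := S ×ˢ (univ : Set X) with hs
  have hU : UniqueDiffOn ℝ s := hS.prod uniqueDiffOn_univ
  have htx : (t, x) ∈ s := mk_mem_prod ht (mem_univ x)
  set A : ℝ × X → (ℝ × X →L[ℝ] F) := fderivWithin ℝ W s with hA
  have hAdiff : ContDiffOn ℝ ∞ A s := h.fderivWithin hU (by simp)
  have hA_at : HasFDerivWithinAt A (fderivWithin ℝ A s (t, x)) s (t, x) :=
    ((hAdiff (t, x) htx).differentiableWithinAt (by simp)).hasFDerivWithinAt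
  -- symmetry of the second derivative within `s` on the pair `((1, 0), (0, v))`
  have hsymm : (fderivWithin ℝ A s (t, x) ((1 : ℝ), (0 : X))) ((0 : ℝ), v) =
      (fderivWithin ℝ A s (t, x) ((0 : ℝ), v)) ((1 : ℝ), (0 : X)) :=
    fderivWithin_fderivWithin_symm_of_prod_univ (h.of_le (by norm_cast)) hS ht x v
  -- (1) slices: `D(w s')(y) v = A (s', y) (0, v)` and `∂ₜ w s' y = A (s', y) (1, 0)` on `S`
  have e1 : ∀ s' ∈ S, ∀ y, fderiv ℝ (w s') y v = A (s', y) ((0 : ℝ), v) := fun s' hs' y => by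
    rw [h.fderiv_slice_eq hs' y]
    rfl
  have e2 : ∀ y, FluidPDE.timeDerivWithin S w t y = A (t, y) ((1 : ℝ), (0 : X)) := fun y =>
    h.timeDerivWithin_eq hS ht y
  -- (2) the left-hand side is `(D A (t,x) (1,0)) (0,v)`
  have hL : FluidPDE.timeDerivWithin S (fun s y => fderiv ℝ (w s) y v) t x =
      (fderivWithin ℝ A s (t, x) ((1 : ℝ), (0 : X))) ((0 : ℝ), v) := by
    rw [timeDerivWithin_apply]
    have hcongr : derivWithin (fun s' => fderiv ℝ (w s') x v) S t =
        derivWithin (fun s' => A (s', x) ((0 : ℝ), v)) S t :=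
      derivWithin_congr (fun s' hs' => e1 s' hs' x) (e1 t ht x)
    rw [hcongr]
    have h2 : HasDerivWithinAt (fun s' : ℝ => ((s', x) : ℝ × X)) ((1 : ℝ), (0 : X)) S t :=
      (hasDerivWithinAt_id t S).prodMk (hasDerivWithinAt_const t S x)
    have h3 : HasDerivWithinAt (fun s' => A (s', x))
        (fderivWithin ℝ A s (t, x) ((1 : ℝ), (0 : X))) S t :=
      hA_at.comp_hasDerivWithinAt t h2 fun s' hs' => mk_mem_prod hs' (mem_univ x)
    have h4 : HasDerivWithinAt (fun s' => A (s', x) ((0 : ℝ), v))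
        ((fderivWithin ℝ A s (t, x) ((1 : ℝ), (0 : X))) ((0 : ℝ), v)) S t := by
      have := h3.clm_apply (hasDerivWithinAt_const t S (((0 : ℝ), v) : ℝ × X))
      simpa using this
    exact h4.derivWithin (hS t ht)
  -- (3) the right-hand side is `(D A (t,x) (0,v)) (1,0)`
  have hR : fderiv ℝ (FluidPDE.timeDerivWithin S w t) x v =
      (fderivWithin ℝ A s (t, x) ((0 : ℝ), v)) ((1 : ℝ), (0 : X)) := by
    have hfun : FluidPDE.timeDerivWithin S w t = fun y => A (t, y) ((1 : ℝ), (0 : X)) := funext e2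
    rw [hfun]
    have h2 : HasFDerivAt (fun y : X => ((t, y) : ℝ × X)) (ContinuousLinearMap.inr ℝ ℝ X) x :=
      hasFDerivAt_prodMk_right t x
    have h3 : HasFDerivAt (fun y => A (t, y))
        ((fderivWithin ℝ A s (t, x)).comp (ContinuousLinearMap.inr ℝ ℝ X)) x :=
      hA_at.comp_hasFDerivAt x h2 (Eventually.of_forall fun y => mk_mem_prod ht (mem_univ y))
    have h4 : HasFDerivAt (fun y => A (t, y) ((1 : ℝ), (0 : X)))
        (((fderivWithin ℝ A s (t, x)).comp (ContinuousLinearMap.inr ℝ ℝ X)).flip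
          ((1 : ℝ), (0 : X))) x := by
      have := h3.clm_apply (hasFDerivAt_const (((1 : ℝ), (0 : X)) : ℝ × X) x)
      simpa using this
    rw [h4.fderiv]
    simp
  rw [hL, hR]
  exact hsymm

end MixedPartials

end Literature.Analysis.FluidPDE
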